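import Literature.Analysis.FluidPDE.FiniteFourierModeEulerSIP
import Literature.Analysis.FluidPDE.FiniteFourierModeEulerGauge

/-!
# Kishimoto–Yoneda, §4: pair sums with vanishing competitors, points of maximal length, faces

Support file for `FiniteFourierModeEuler` (N. Kishimoto, T. Yoneda, J. Math. Fluid Mech. 24
(2022) 74 = arXiv:2110.08039), auxiliary facts for the proof of **Proposition 4.8**, PROVED:

* `nonInteracting_of_others_vanish`: at an unoccupied frequency `m = a + b`, if every OTHER pair
  of distinct occupied frequencies summing to `m` does not interact, then neither does `(a, b)`
  ("there must be another pair … which creates nonzero contribution");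
* `exposed_of_dot_self_eq_max`: a point of `S` of maximal length is a vertex of `S^{conv}`
  exposed by `x ↦ a·x`;
* `mem_convexHull_filter_of_dot_eq_max`: the face of `S^{conv}` cut out by a supporting
  functional is the convex hull of the points of `S` on it ("`S^{conv} ∩ {f = 1} = F`").

## References

* [KishimotoYoneda2022] N. Kishimoto, T. Yoneda, J. Math. Fluid Mech. 24 (2022) 74 =
  arXiv:2110.08039, §4 proof of Prop. 4.8.
-/

noncomputable section

open Matrix Finset Set

namespace Literature.Analysis.FluidPDE

namespace KY

/-- **A point of maximal length is an exposed vertex** (by its own direction).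
[cite: KishimotoYoneda2022, §4 Prop. 4.4 (i) (vertices on the circumscribed sphere)] -/
theorem exposed_of_dot_self_eq_max {S : Finset (Fin 3 → ℝ)} {a : Fin 3 → ℝ}
    (hmax : ∀ s ∈ S, s ⬝ᵥ s ≤ a ⬝ᵥ a) : ∀ s ∈ S, s ≠ a → a ⬝ᵥ s < a ⬝ᵥ a := by
  intro s hs hsa
  have hpos : 0 < (a - s) ⬝ᵥ (a - s) := by
    rcases (show 0 ≤ (a - s) ⬝ᵥ (a - s) from by
      rw [KY.real_dot_eq]; nlinarith [sq_nonneg ((a - s) 0), sq_nonneg ((a - s) 1), sq_nonneg ((a - s) 2)]).lt_or_eq with h | h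
    · exact h
    · exact absurd (sub_eq_zero.1 (dotProduct_self_eq_zero.1 h.symm)).symm hsa
  have h := hmax s hs
  simp only [sub_dotProduct, dotProduct_sub, dotProduct_comm s a] at hpos
  linarith

/-- **Faces of `S^{conv}`**: a point of the convex hull at which a functional bounded by `M` on
`S` attains `M` lies in the convex hull of the points of `S` at level `M`.
[cite: KishimotoYoneda2022, §4 proof of Prop. 4.8 ("`S^{conv} ∩ {f(n) = 1} = F`")] -/
theorem mem_convexHull_filter_of_dot_eq_max {S : Finset (Fin 3 → ℝ)} {φ x : Fin 3 → ℝ} {M : ℝ}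
    (hM : ∀ s ∈ S, φ ⬝ᵥ s ≤ M) (hx : x ∈ convexHull ℝ (S : Set (Fin 3 → ℝ))) (hφx : φ ⬝ᵥ x = M) :
    x ∈ convexHull ℝ ((S.filter fun s => φ ⬝ᵥ s = M : Finset (Fin 3 → ℝ)) : Set (Fin 3 → ℝ)) := by
  classical
  rw [Finset.mem_convexHull] at hx
  obtain ⟨w, hw0, hw1, hwx⟩ := hx
  -- the weights vanish off the face
  have hx' : ∑ s ∈ S, w s • s = x := by
    rw [← hwx, Finset.centerMass_eq_of_sum_1 _ _ hw1]; rfl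
  have hsum : ∑ s ∈ S, w s * (M - φ ⬝ᵥ s) = 0 := by
    have h1 : ∑ s ∈ S, w s * (φ ⬝ᵥ s) = φ ⬝ᵥ x := by
      rw [← hx', dotProduct_sum]
      simp only [dotProduct_smul, smul_eq_mul]
    simp only [mul_sub, Finset.sum_sub_distrib, ← Finset.sum_mul, hw1, one_mul, h1, hφx, sub_self]
  have hzero : ∀ s ∈ S, φ ⬝ᵥ s ≠ M → w s = 0 := by
    intro s hs hne
    have hnn : ∀ s' ∈ S, 0 ≤ w s' * (M - φ ⬝ᵥ s') :=
      fun s' hs' => mul_nonneg (hw0 s' hs') (sub_nonneg.2 (hM s' hs'))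
    have := (Finset.sum_eq_zero_iff_of_nonneg hnn).1 hsum s hs
    rcases mul_eq_zero.1 this with h | h
    · exact h
    · exact absurd (by linarith : φ ⬝ᵥ s = M) hne
  have hfilter_w : ∑ s ∈ S.filter (fun s => φ ⬝ᵥ s = M), w s = 1 := by
    rw [Finset.sum_filter_of_ne (fun s hs h0 => by_contra fun h => h0 (hzero s hs h)), hw1]
  rw [Finset.mem_convexHull]
  refine ⟨w, fun s hs => hw0 s (Finset.mem_filter.1 hs).1, hfilter_w, ?_⟩
  rw [Finset.centerMass_eq_of_sum_1 _ _ hfilter_w]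
  have : ∑ s ∈ S.filter (fun s => φ ⬝ᵥ s = M), w s • s = ∑ s ∈ S, w s • s := by
    apply Finset.sum_filter_of_ne
    intro s hs h0
    by_contra h
    apply h0
    rw [hzero s hs h, zero_smul]
  simpa [this] using hx'

end KY

namespace KY.IsFiniteModeEulerSolution

open KY

variable {I : Set ℝ} {S : Finset (Fin 3 → ℝ)} {u : (Fin 3 → ℝ) → ℝ → (Fin 3 → ℂ)}

open scoped Classical in
/-- **Cancellation at an unoccupied frequency.** If `a ≠ b ∈ S`, `a + b ∉ S`, and every other
pair `{c, e} ≠ {a, b}` of distinct points of `S` with `c + e = a + b` does not interact at time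
`t`, then `(a, b)` does not interact at time `t` either. [cite: KishimotoYoneda2022, §4 proof of Prop. 4.8 ("there must be another pair `{n₂, n₃} ⊂ S` … creates nonzero contribution")] -/
theorem nonInteracting_of_others_vanish (hS : IsFiniteModeEulerSolution I S u) {a b : Fin 3 → ℝ}
    (ha : a ∈ S) (hb : b ∈ S) (hab : a ≠ b) (hsum : a + b ∉ S) {t : ℝ} (ht : t ∈ I)
    (hothers : ∀ c ∈ S, ∀ e ∈ S, c ≠ e → c + e = a + b → ¬ (c = a ∧ e = b) → ¬ (c = b ∧ e = a) →
      NonInteracting c e (u c t) (u e t)) :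
    NonInteracting a b (u a t) (u b t) := by
  by_cases hm0 : a + b = 0
  · have hk : a ⨯₃ b = 0 := by
      have : b = -a := by rw [← sub_eq_zero, sub_neg_eq_add, add_comm, hm0]
      rw [this, LinearMap.map_neg, cross_self, neg_zero]
    exact nonInteracting_of_cross_eq_zero (hS.ne_zero_of_mem ha) (hS.ne_zero_of_mem hb) hk
      (hS.div_free a ha t ht) (hS.div_free b hb t ht)
  have hsum0 := hS.sum_proj_bracket_eq_zero hsum hm0 ht
  set T := (S ×ˢ S).filter (fun q => q.1 + q.2 = a + b) with hT
  have hmem₁ : (a, b) ∈ T := by simp [hT, ha, hb]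
  have hmem₂ : (b, a) ∈ T := by simp [hT, ha, hb, add_comm]
  have hne' : (a, b) ≠ (b, a) := by
    intro h; exact hab (Prod.ext_iff.1 h).1
  rw [Finset.sum_eq_add_of_mem _ _ hmem₁ hmem₂ hne'] at hsum0
  · rw [bracket_comm a b] at hsum0
    have : (2 : ℂ) • proj (a + b) (bracket a b (u a t) (u b t)) = 0 := by
      rw [two_smul]; exact hsum0
    exact (smul_eq_zero.1 this).resolve_left two_ne_zero
  · rintro ⟨c, e⟩ hq ⟨hq1, hq2⟩
    simp only [hT, Finset.mem_filter, Finset.mem_product] at hq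
    obtain ⟨⟨hc, he⟩, hce⟩ := hq
    by_cases hdiag : c = e
    · subst hdiag
      rw [hS.bracket_self hc ht, proj_zero]
    · have h1 : ¬ (c = a ∧ e = b) := fun h => hq1 (Prod.ext h.1 h.2)
      have h2 : ¬ (c = b ∧ e = a) := fun h => hq2 (Prod.ext h.1 h.2)
      have := hothers c hc e he hdiag hce h1 h2
      rwa [NonInteracting, hce] at this

end KY.IsFiniteModeEulerSolution

end Literature.Analysis.FluidPDE
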